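import Summits.HubbardSuperconductivity.HubbardSuperconductivity.Theorems.ChiralWindowCwThesisReductions
import Summits.HubbardSuperconductivity.HubbardSuperconductivity.Theorems.AbelianDualityThermalToGroundAverage
import Literature.MathematicalPhysics.QuantumLattice.GroundStateSourceBounds
import Literature.MathematicalPhysics.QuantumLattice.ApproximateEigenvectorLemmas
import Literature.MathematicalPhysics.QuantumLattice.DWaveSourceProofs
import HarnessLib

/-!
# Route `ChiralWindow`, crux `CwThesis` (stmt-HubbardSuperconductivity-10438), line `SketchIdeator3`:
# the thermal engine is EQUIVALENT to the `T = 0` penalty-response family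

The lead skeleton of line `SketchIdeator3` (`Cruxes/CwThesis/Lines/SketchIdeator3.lean`) closes the crux
`ChiralWindow.CwThesis` modulo ONE stub, the thermal engine C⁺⁺ (`stub_gibbsPenaltyFloor`): for every weak
`U` a doping `δ_U ∈ [3/10, 12/25]` and `κ, a, M > 0`, `2 log 4 ≤ M κ a`, with, eventually along `L = 2(k+1)`,
`a L⁴ ≤ Re ω_{β = M L², H_p + (κ/L⁴) Q_p}(Q_p)` (`H_p`, `Q_p` the compressions of `hubbardTorus 2 L 1 U` and
`Q = Δ_d†Δ_d` to Lieb's `(n,n)` block, `2n = N_L(δ_U)`). The landed reductions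
(`Theorems/ChiralWindowCwThesisReductions.lean`) prove C⁺⁺ ⇒ C⁺ ⇒ X, where C⁺ is the `T = 0` penalty-response
family `c·κ ≤ E_L(U;κ) - E_L(U;0)` of the sector ground energies — word for word the conclusion of the sibling
crux `TorusCooperLog.KLCanonical` (stmt-HubbardSuperconductivity-2681) at a window doping, with `∀ U ∃ δ`.

This file proves the CONVERSE C⁺ ⇒ C⁺⁺ (`gibbsPenaltyFloor_of_penaltyResponseWindow`) and records the
equivalence (`gibbsPenaltyFloor_iff_penaltyResponseWindow`): the thermal dress of the engine neither adds
nor removes strength, so the one open stub of the line IS the `∀ U ∃ δ`-form of `KLCanonical`'s conclusion.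

Mechanism (finite-dimensional, folklore):
* `groundEnergy_response_between` — concavity bookkeeping at `T = 0`: if `c K ≤ E₀(H + K Y) - E₀(H)` then for
  `0 ≤ κ < κ' < K` with `κ' ‖Y‖ ≤ c K / 2` the response persists between `κ` and `κ'`:
  `(c/2)(κ' - κ) ≤ E₀(H + κ' Y) - E₀(H + κ Y)` (three uses of the Griffiths / Hellmann–Feynman source
  inequality `sub_mul_re_groundStateFunctional_le` for the tracial ground state of `H + κ' Y`, and
  `|Re ω(Y)| ≤ ‖Y‖`);
* `re_gibbsState_ge_of_response_between` — the thermal ascent (`thermalPenaltyAscent`: Peierls–Bogoliubov +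
  entropy sandwich) with base `H + κ Y` turns a response between `κ` and `κ'` into a floor on the PENALISED
  Gibbs expectation: `c/2 - log|m| / (β (κ' - κ)) ≤ Re ω_{β, H + κY}(Y)`;
* `norm_pairIntensity_toBlock_le` — `‖Q_p‖ ≤ ‖Δ_d‖² ≤ (c_d L²)²` (compression does not increase the norm,
  `norm_toBlock_le`; `‖Δ_g‖ ≤ c_g L²`, `norm_pairField_le`), so all constants are `L`-independent:
  `κ := min (K/4) (cK/(4B₀))`, `κ' := 2κ`, `a := c/3`, `M := 6 log 4 / (κ c)` (then `M κ a = 2 log 4`).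

Tasaki (2020) §2.1, App. A; Ruelle (1969) §2.5; Griffiths (1966). No definition is introduced.
-/

noncomputable section

namespace Summit.HubbardSuperconductivity.HubbardSuperconductivity.Theorems.CwThesis

-- `Summit.HubbardSuperconductivity.HubbardSuperconductivity.…` repeats the summit name by design (D-0017 layout)
set_option linter.dupNamespace false
-- `DecidableEq {s : Finset (Orb Λ) // …}` (the `(n,n)`-block index) exceeds the default instance size budget
set_option synthInstance.maxSize 512

open Matrix Filter Literature.MathematicalPhysics.QuantumLattice Literature.Probability.LatticeModels
open Summit.HubbardSuperconductivity.HubbardSuperconductivity.Theses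
open scoped ComplexOrder Matrix.Norms.L2Operator

/-! ### `T = 0`: the response persists between two small couplings -/

section Abstract

variable {m : Type*} [Fintype m] [DecidableEq m] [Nonempty m]

/-- Source inequality in coupling form: for Hermitian `H`, `Y` and real `t`, `t'`,
`E₀(H + t'Y) - E₀(H + tY) ≤ (t' - t) · Re ω_{H + tY}(Y)` (the tracial ground state of `H + tY` is a trial
state for `H + t'Y`; `sub_mul_re_groundStateFunctional_le` with sources `-t`, `-t'`). [folklore] -/
theorem groundEnergy_add_smul_sub_le (H Y : Matrix m m ℂ) (hH : H.IsHermitian) (hY : Y.IsHermitian)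
    (t t' : ℝ) :
    (H + (t' : ℂ) • Y).groundEnergy - (H + (t : ℂ) • Y).groundEnergy ≤
      (t' - t) * ((H + (t : ℂ) • Y).groundStateFunctional Y).re := by
  have h := sub_mul_re_groundStateFunctional_le hH hY (-t) (-t')
  have e1 : H - ((-t : ℝ) : ℂ) • Y = H + (t : ℂ) • Y := by
    rw [Complex.ofReal_neg, neg_smul, sub_neg_eq_add]
  have e2 : H - ((-t' : ℝ) : ℂ) • Y = H + (t' : ℂ) • Y := by
    rw [Complex.ofReal_neg, neg_smul, sub_neg_eq_add]
  rw [e1, e2] at h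
  linarith

/-- **The response persists between two small couplings.** For Hermitian `H`, `Y` on a nonempty finite
index type, `0 < K`, `0 < c` with the response `c K ≤ E₀(H + K Y) - E₀(H)`, and couplings
`0 ≤ κ < κ' < K` with `κ' ‖Y‖ ≤ c K / 2`: `(c/2) (κ' - κ) ≤ E₀(H + κ' Y) - E₀(H + κ Y)`.
Proof: with `q := Re ω_{H + κ'Y}(Y)`, the source inequality gives `E₀(H+KY) - E₀(H+κ'Y) ≤ (K-κ') q`,
`E₀(H+κY) - E₀(H+κ'Y) ≤ (κ-κ') q` and `E₀(H+κ'Y) - E₀(H) ≤ κ' Re ω_H(Y) ≤ κ' ‖Y‖ ≤ cK/2`; hence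
`(K-κ') q ≥ cK/2`, so `q ≥ c/2`, and `E₀(H+κ'Y) - E₀(H+κY) ≥ (κ'-κ) q`. [folklore] -/
theorem groundEnergy_response_between (H Y : Matrix m m ℂ) (hH : H.IsHermitian) (hY : Y.IsHermitian)
    {K c κ κ' : ℝ} (hc : 0 < c)
    (hresp : c * K ≤ (H + (K : ℂ) • Y).groundEnergy - H.groundEnergy)
    (hκ0 : 0 ≤ κ) (hκκ' : κ < κ') (hκ'K : κ' < K) (hκ'B : κ' * ‖Y‖ ≤ c * K / 2) :
    c / 2 * (κ' - κ) ≤ (H + (κ' : ℂ) • Y).groundEnergy - (H + (κ : ℂ) • Y).groundEnergy := by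
  set q : ℝ := ((H + (κ' : ℂ) • Y).groundStateFunctional Y).re with hq
  -- (a) from `κ'` up to `K`
  have ha := groundEnergy_add_smul_sub_le H Y hH hY κ' K
  -- (b) from `κ'` down to `κ`
  have hb := groundEnergy_add_smul_sub_le H Y hH hY κ' κ
  -- (c) from `0` up to `κ'`, and `Re ω_H(Y) ≤ ‖Y‖`
  have hc' := groundEnergy_add_smul_sub_le H Y hH hY 0 κ'
  have h0 : H + ((0 : ℝ) : ℂ) • Y = H := by rw [Complex.ofReal_zero, zero_smul, add_zero]
  rw [h0, sub_zero] at hc'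
  have hω : (H.groundStateFunctional Y).re ≤ ‖Y‖ :=
    (le_abs_self _).trans (abs_re_groundStateFunctional_le_norm hH Y)
  have hκ'0 : 0 ≤ κ' := hκ0.trans hκκ'.le
  have hc'' : (H + (κ' : ℂ) • Y).groundEnergy - H.groundEnergy ≤ c * K / 2 :=
    hc'.trans ((mul_le_mul_of_nonneg_left hω hκ'0).trans hκ'B)
  -- hence `(K - κ') q ≥ c K / 2`, so `q ≥ c / 2`
  have hKq : c * K / 2 ≤ (K - κ') * q := by rw [hq]; linarith
  have hq2 : c / 2 ≤ q := by
    by_contra hlt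
    rw [not_le] at hlt
    have h1 : (K - κ') * q < (K - κ') * (c / 2) := mul_lt_mul_of_pos_left hlt (by linarith)
    nlinarith
  -- and `E₀(H+κ'Y) - E₀(H+κY) ≥ (κ' - κ) q ≥ (κ' - κ) c/2`
  have hb' : (κ' - κ) * q ≤ (H + (κ' : ℂ) • Y).groundEnergy - (H + (κ : ℂ) • Y).groundEnergy := by
    rw [hq]; linarith
  calc c / 2 * (κ' - κ) = (κ' - κ) * (c / 2) := by ring
    _ ≤ (κ' - κ) * q := mul_le_mul_of_nonneg_left hq2 (by linarith)
    _ ≤ _ := hb'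

/-- **A response between `κ` and `κ'` floors the PENALISED Gibbs expectation.** For Hermitian `H`, `Y`,
`β > 0` and `κ < κ'`: if `C (κ' - κ) ≤ E₀(H + κ'Y) - E₀(H + κY)` then
`C - log |m| / (β (κ' - κ)) ≤ Re ω_{β, H + κY}(Y)` (thermal ascent `thermalPenaltyAscent` with base `H + κY`
and perturbation `(κ' - κ) Y`). [folklore] -/
theorem re_gibbsState_ge_of_response_between (H Y : Matrix m m ℂ) (hH : H.IsHermitian)
    (hY : Y.IsHermitian) {β C κ κ' : ℝ} (hβ : 0 < β) (hκκ' : κ < κ')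
    (hresp : C * (κ' - κ) ≤ (H + (κ' : ℂ) • Y).groundEnergy - (H + (κ : ℂ) • Y).groundEnergy) :
    C - Real.log (Fintype.card m) / (β * (κ' - κ)) ≤ (Matrix.gibbsState β (H + (κ : ℂ) • Y) Y).re := by
  have hHκ : (H + (κ : ℂ) • Y).IsHermitian := hH.add (IsHermitian.smul hY (Complex.conj_ofReal κ))
  have hasc := thermalPenaltyAscent (H + (κ : ℂ) • Y) Y hHκ hY hβ (κ' - κ)
  have e : H + (κ : ℂ) • Y + ((κ' - κ : ℝ) : ℂ) • Y = H + (κ' : ℂ) • Y := by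
    rw [add_assoc, ← add_smul, ← Complex.ofReal_add, add_sub_cancel]
  rw [e] at hasc
  have hd : 0 < κ' - κ := sub_pos.2 hκκ'
  have key : C - Real.log (Fintype.card m) / β / (κ' - κ) ≤ (Matrix.gibbsState β (H + (κ : ℂ) • Y) Y).re := by
    rw [sub_le_iff_le_add, ← sub_le_iff_le_add', le_div_iff₀ hd]
    · have : C * (κ' - κ) - Real.log (Fintype.card m) / β ≤
          (κ' - κ) * (Matrix.gibbsState β (H + (κ : ℂ) • Y) Y).re := by linarith
      linarith
  rwa [div_div] at key

end Abstract

/-! ### The pair intensity on a block is `O(L⁴)` in norm -/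

/-- The `d`-wave norm constant `c_d := 2 Σ_{e ∈ {0, ±e₁, ±e₂}} |d(e)/√2|` of `norm_pairField_le`
(`‖Δ_d‖ ≤ c_d L²`); only `0 ≤ c_d` is used below. [folklore] -/
theorem dWaveNormConst_nonneg :
    0 ≤ 2 * ∑ e ∈ insert (0 : Site 2) unitSteps, |dWaveFormFactor e / Real.sqrt 2| := by
  positivity

/-- **The compressed pair intensity is `O(L⁴)` in operator norm**: for `L ≠ 0` and any block `p` of the
Fock space of the torus, `‖(Δ_d†Δ_d).toBlock p p‖ ≤ (c_d L²)²` (`norm_toBlock_le`,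
`‖AᴴA‖ = ‖A‖²`, `norm_pairField_le`). [folklore] -/
theorem norm_pairIntensity_toBlock_le (L : ℕ) [NeZero L]
    (p : Finset (Orb (FermionTorus 2 L)) → Prop) [DecidablePred p] :
    ‖((pairField dWaveFormFactor L)ᴴ * pairField dWaveFormFactor L).toBlock p p‖ ≤
      ((2 * ∑ e ∈ insert (0 : Site 2) unitSteps, |dWaveFormFactor e / Real.sqrt 2|) * (L : ℝ) ^ 2) ^ 2 := by
  refine (norm_toBlock_le _ p).trans ?_
  rw [Matrix.l2_opNorm_conjTranspose_mul_self, sq]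
  have h := norm_pairField_le dWaveFormFactor L
  exact mul_le_mul h h (norm_nonneg _) ((norm_nonneg _).trans h)

/-! ### C⁺ ⇒ C⁺⁺ on one torus -/

/-- **Penalty response ⇒ penalised Gibbs floor, on one torus.** On the torus of side `L ≠ 0`, with
`H = hubbardTorus 2 L 1 U`, `Q = Δ_d†Δ_d`, `n ≤ L²`, `S = szSector (2n) 0` and `c_d` the `d`-wave norm
constant: if `c K ≤ minEnergyOn (H + (K/L⁴) Q) S - minEnergyOn H S` with `c > 0`, and `κ > 0` is
small (`4κ ≤ K` and `4 κ c_d² ≤ c K`; both conditions are `L`-free), then for every `M > 0` the Gibbs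
state of the penalised `(n,n)` block `H_p + (κ/L⁴) Q_p` at `β = M L²` satisfies
`(c/2 - log 4/(M κ)) L⁴ ≤ Re ω(Q_p)`. (`groundEnergy_response_between` on the block
with couplings `κ/L⁴ < 2κ/L⁴ < K/L⁴`, block ground energies = sector energies, `‖Q_p‖ ≤ (c_d L²)²`, then
`re_gibbsState_ge_of_response_between` and the entropy price `log |p| ≤ L² log 4`.) [folklore] -/
theorem gibbsFloor_of_penaltyResponse (L : ℕ) [NeZero L] (U : ℝ) {n : ℕ} (hn : n ≤ L ^ 2)
    {K c κ M : ℝ} (hc : 0 < c) (hκ : 0 < κ) (hM : 0 < M) (hκK : 4 * κ ≤ K)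
    (hκB : 4 * κ * (2 * ∑ e ∈ insert (0 : Site 2) unitSteps, |dWaveFormFactor e / Real.sqrt 2|) ^ 2 ≤
      c * K)
    (hresp : c * K ≤ Matrix.minEnergyOn (hubbardTorus 2 L 1 U + ((K / (L : ℝ) ^ 4 : ℝ) : ℂ) •
        ((pairField dWaveFormFactor L)ᴴ * pairField dWaveFormFactor L)) (szSector (2 * n) 0) -
      Matrix.minEnergyOn (hubbardTorus 2 L 1 U) (szSector (2 * n) 0)) :
    (c / 2 - Real.log 4 / (M * κ)) * (L : ℝ) ^ 4 ≤
      (Matrix.gibbsState (M * (L : ℝ) ^ 2)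
        ((hubbardTorus 2 L 1 U).toBlock (fun s => (upPart s).card = n ∧ (downPart s).card = n)
            (fun s => (upPart s).card = n ∧ (downPart s).card = n) +
          ((κ / (L : ℝ) ^ 4 : ℝ) : ℂ) •
            ((pairField dWaveFormFactor L)ᴴ * pairField dWaveFormFactor L).toBlock
              (fun s => (upPart s).card = n ∧ (downPart s).card = n)
              (fun s => (upPart s).card = n ∧ (downPart s).card = n))
        (((pairField dWaveFormFactor L)ᴴ * pairField dWaveFormFactor L).toBlock
          (fun s => (upPart s).card = n ∧ (downPart s).card = n)
          (fun s => (upPart s).card = n ∧ (downPart s).card = n))).re := by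
  -- names
  set H : Matrix (Finset (Orb (FermionTorus 2 L))) (Finset (Orb (FermionTorus 2 L))) ℂ :=
    hubbardTorus 2 L 1 U with hHdef
  set Q : Matrix (Finset (Orb (FermionTorus 2 L))) (Finset (Orb (FermionTorus 2 L))) ℂ :=
    (pairField dWaveFormFactor L)ᴴ * pairField dWaveFormFactor L with hQdef
  set cd : ℝ := 2 * ∑ e ∈ insert (0 : Site 2) unitSteps, |dWaveFormFactor e / Real.sqrt 2| with hcd
  set ℓ : ℝ := (L : ℝ) with hℓ
  have hHh : H.IsHermitian := hubbardTorus_isHermitian (hamiltonian_isHermitian_and_commute_holds _) 1 U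
  have hQh : Q.IsHermitian := isHermitian_conjTranspose_mul_self _
  have hℓpos : 0 < ℓ := by
    rw [hℓ]; exact_mod_cast Nat.pos_of_ne_zero (NeZero.ne L)
  have hℓ4 : 0 < ℓ ^ 4 := by positivity
  have hcardT : Fintype.card (FermionTorus 2 L) = L ^ 2 := by simp [FermionTorus, Fintype.card_lex]
  haveI : Nonempty {s : Finset (Orb (FermionTorus 2 L)) // (upPart s).card = n ∧ (downPart s).card = n} :=
    nonempty_sectorConfigs (hn.trans hcardT.symm.le)
  -- the blocks
  set Hp := H.toBlock (fun s => (upPart s).card = n ∧ (downPart s).card = n)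
    (fun s => (upPart s).card = n ∧ (downPart s).card = n) with hHp
  set Qp := Q.toBlock (fun s => (upPart s).card = n ∧ (downPart s).card = n)
    (fun s => (upPart s).card = n ∧ (downPart s).card = n) with hQp
  have hHph : Hp.IsHermitian := hHh.submatrix _
  have hQph : Qp.IsHermitian := hQh.submatrix _
  -- K > 0 (from 0 < κ, 4κ ≤ K)
  have hK : 0 < K := by linarith
  -- block response at coupling `K/ℓ⁴`: `(c ℓ⁴) (K/ℓ⁴) ≤ E₀(Hp + (K/ℓ⁴) Qp) - E₀(Hp)`
  have hHK : (H + ((K / ℓ ^ 4 : ℝ) : ℂ) • Q).IsHermitian :=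
    hHh.add (IsHermitian.smul hQh (Complex.conj_ofReal _))
  have hE0 := stub_blockGroundEnergy L H hHh hn
  have hEK := stub_blockGroundEnergy L _ hHK hn
  rw [toBlock_add_smul] at hEK
  have hresp' : c * ℓ ^ 4 * (K / ℓ ^ 4) ≤ (Hp + ((K / ℓ ^ 4 : ℝ) : ℂ) • Qp).groundEnergy - Hp.groundEnergy := by
    rw [hHp, hQp, hE0, hEK]
    have : c * ℓ ^ 4 * (K / ℓ ^ 4) = c * K := by field_simp
    rw [this]
    exact hresp
  -- the norm of the compressed pair intensity
  have hQpn : ‖Qp‖ ≤ (cd * ℓ ^ 2) ^ 2 := norm_pairIntensity_toBlock_le L _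
  -- `T = 0` response between `κ/ℓ⁴` and `2κ/ℓ⁴`
  have hcℓ : 0 < c * ℓ ^ 4 := by positivity
  have hκ0' : 0 ≤ κ / ℓ ^ 4 := by positivity
  have hκκ' : κ / ℓ ^ 4 < 2 * κ / ℓ ^ 4 := by
    rw [div_lt_div_iff_of_pos_right hℓ4]; linarith
  have hκ'K : 2 * κ / ℓ ^ 4 < K / ℓ ^ 4 := by
    rw [div_lt_div_iff_of_pos_right hℓ4]; linarith
  have hκ'B : 2 * κ / ℓ ^ 4 * ‖Qp‖ ≤ c * ℓ ^ 4 * (K / ℓ ^ 4) / 2 := by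
    have h1 : 2 * κ / ℓ ^ 4 * ‖Qp‖ ≤ 2 * κ / ℓ ^ 4 * (cd * ℓ ^ 2) ^ 2 :=
      mul_le_mul_of_nonneg_left hQpn (by positivity)
    have h2 : 2 * κ / ℓ ^ 4 * (cd * ℓ ^ 2) ^ 2 = 2 * κ * cd ^ 2 := by
      field_simp
    have h3 : c * ℓ ^ 4 * (K / ℓ ^ 4) / 2 = c * K / 2 := by
      field_simp
    rw [h2] at h1
    rw [h3]
    have h4 : 2 * κ * cd ^ 2 ≤ c * K / 2 := by rw [hcd]; linarith
    exact h1.trans h4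
  have hbetween := groundEnergy_response_between Hp Qp hHph hQph hcℓ hresp' hκ0' hκκ' hκ'K hκ'B
  -- thermal floor at `β = M ℓ²`
  have hβ : 0 < M * ℓ ^ 2 := by positivity
  have hfloor := re_gibbsState_ge_of_response_between Hp Qp hHph hQph hβ hκκ' hbetween
  -- entropy price `log |p| ≤ ℓ² log 4`
  have hcard := card_sectorConfigs_le (Λ := FermionTorus 2 L) n
  rw [hcardT] at hcard
  have hcard_pos : (0 : ℝ) <
      Fintype.card {s : Finset (Orb (FermionTorus 2 L)) // (upPart s).card = n ∧ (downPart s).card = n} := by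
    exact_mod_cast Fintype.card_pos
  have hlog : Real.log
      (Fintype.card {s : Finset (Orb (FermionTorus 2 L)) // (upPart s).card = n ∧ (downPart s).card = n}) ≤
      ℓ ^ 2 * Real.log 4 := by
    calc Real.log (Fintype.card {s : Finset (Orb (FermionTorus 2 L)) // (upPart s).card = n ∧ (downPart s).card = n})
        ≤ Real.log ((4 : ℝ) ^ (L ^ 2)) := Real.log_le_log hcard_pos hcard
      _ = ℓ ^ 2 * Real.log 4 := by rw [Real.log_pow, hℓ]; push_cast; ring
  have hd : M * ℓ ^ 2 * (2 * κ / ℓ ^ 4 - κ / ℓ ^ 4) = M * κ / ℓ ^ 2 := by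
    field_simp
    ring
  rw [hd] at hfloor
  have hMκ : 0 < M * κ / ℓ ^ 2 := by positivity
  have hprice : Real.log
      (Fintype.card {s : Finset (Orb (FermionTorus 2 L)) // (upPart s).card = n ∧ (downPart s).card = n}) /
      (M * κ / ℓ ^ 2) ≤ Real.log 4 / (M * κ) * ℓ ^ 4 := by
    rw [div_le_iff₀ hMκ]
    have : Real.log 4 / (M * κ) * ℓ ^ 4 * (M * κ / ℓ ^ 2) = ℓ ^ 2 * Real.log 4 := by
      field_simp
    rw [this]
    exact hlog
  have hgoal : (c / 2 - Real.log 4 / (M * κ)) * ℓ ^ 4 ≤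
      c * ℓ ^ 4 / 2 - Real.log
        (Fintype.card {s : Finset (Orb (FermionTorus 2 L)) // (upPart s).card = n ∧ (downPart s).card = n}) /
        (M * κ / ℓ ^ 2) := by
    rw [sub_mul]
    linarith
  exact hgoal.trans hfloor

/-! ### The two families: C⁺ (penalty response) ⇔ C⁺⁺ (the thermal engine) -/

/-- **C⁺ ⇒ C⁺⁺ (the converse reduction).** If for every weak `U` there are `δ_U ∈ [3/10, 12/25]` and
`K, c > 0` with the eventual `T = 0` penalty response `c·K ≤ E_L(U;K) - E_L(U;0)` along `L = 2(k+1)` (the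
hypothesis of `cwThesis_of_penaltyResponse`; at fixed `δ` it is the conclusion of `TorusCooperLog.KLCanonical`),
then the thermal engine `stub_gibbsPenaltyFloor` of line `SketchIdeator3` holds, with
`κ := min (K/4) (cK/(4(c_d²+1)))`, `a := c/3`, `M := 6 log 4/(κ c)` (so `M κ a = 2 log 4`). [folklore] -/
theorem gibbsPenaltyFloor_of_penaltyResponseWindow
    (h : ∃ U₀ : ℝ, 0 < U₀ ∧ ∀ U ∈ Set.Ioo (0:ℝ) U₀, ∃ δ ∈ Set.Icc (3/10 : ℝ) (12/25),
      ∃ κ : ℝ, 0 < κ ∧ ∃ c : ℝ, 0 < c ∧ ∀ᶠ k : ℕ in Filter.atTop,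
        c * κ ≤ Matrix.minEnergyOn (hubbardTorus 2 (2 * (k + 1)) 1 U +
            ((κ / ((2 * (k + 1) : ℕ) : ℝ) ^ 4 : ℝ) : ℂ) •
              ((pairField dWaveFormFactor (2 * (k + 1)))ᴴ * pairField dWaveFormFactor (2 * (k + 1))))
            (szSector (2 * ⌊(1 - δ) * ((2 * (k + 1) : ℕ) : ℝ) ^ 2 / 2⌋₊) 0) -
          Matrix.minEnergyOn (hubbardTorus 2 (2 * (k + 1)) 1 U)
            (szSector (2 * ⌊(1 - δ) * ((2 * (k + 1) : ℕ) : ℝ) ^ 2 / 2⌋₊) 0)) :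
    ∃ U₀ : ℝ, 0 < U₀ ∧ ∀ U ∈ Set.Ioo (0:ℝ) U₀, ∃ δ ∈ Set.Icc (3/10 : ℝ) (12/25), ∃ κ a M : ℝ, 0 < κ ∧ 0 < a ∧ 0 < M ∧ 2 * Real.log 4 ≤ M * κ * a ∧ ∀ᶠ k : ℕ in atTop, let L : ℕ := 2 * (k + 1); let n : ℕ := ⌊(1 - δ) * (L : ℝ) ^ 2 / 2⌋₊; let Hp := (hubbardTorus 2 L 1 U).toBlock (fun s => (upPart s).card = n ∧ (downPart s).card = n) (fun s => (upPart s).card = n ∧ (downPart s).card = n); let Qp := ((pairField dWaveFormFactor L)ᴴ * pairField dWaveFormFactor L).toBlock (fun s => (upPart s).card = n ∧ (downPart s).card = n) (fun s => (upPart s).card = n ∧ (downPart s).card = n); a * (L : ℝ) ^ 4 ≤ (Matrix.gibbsState (M * (L : ℝ) ^ 2) (Hp + ((κ / (L : ℝ) ^ 4 : ℝ) : ℂ) • Qp) Qp).re := by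
  obtain ⟨U₀, hU₀, hU⟩ := h
  refine ⟨U₀, hU₀, fun U hUm => ?_⟩
  obtain ⟨δ, hδ, K, hK, c, hc, hev⟩ := hU U hUm
  set cd : ℝ := 2 * ∑ e ∈ insert (0 : Site 2) unitSteps, |dWaveFormFactor e / Real.sqrt 2| with hcd
  have hcd0 : 0 ≤ cd := dWaveNormConst_nonneg
  set κ : ℝ := min (K / 4) (c * K / (4 * (cd ^ 2 + 1))) with hκdef
  have hB1 : 0 < cd ^ 2 + 1 := by positivity
  have hκpos : 0 < κ := lt_min (by positivity) (by positivity)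
  have hκK : 4 * κ ≤ K := by
    have : κ ≤ K / 4 := min_le_left _ _
    linarith
  have hκB : 4 * κ * cd ^ 2 ≤ c * K := by
    have h1 : κ ≤ c * K / (4 * (cd ^ 2 + 1)) := min_le_right _ _
    rw [le_div_iff₀ (by positivity)] at h1
    nlinarith [sq_nonneg cd, hκpos.le]
  have hlog4 : 0 < Real.log 4 := Real.log_pos (by norm_num)
  set M : ℝ := 6 * Real.log 4 / (κ * c) with hMdef
  have hMpos : 0 < M := by positivity
  refine ⟨δ, hδ, κ, c / 3, M, hκpos, by positivity, hMpos, ?_, ?_⟩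
  · -- `M κ (c/3) = 2 log 4`
    have : M * κ * (c / 3) = 2 * Real.log 4 := by
      rw [hMdef]; field_simp; ring
    rw [this]
  · filter_upwards [hev] with k hk
    dsimp only
    have hδ0 : (0 : ℝ) ≤ δ := by linarith [hδ.1]
    -- `⌊(1-δ)L²/2⌋ ≤ L²` for `δ ≥ 0`
    have hn : ⌊(1 - δ) * (((2 * (k + 1) : ℕ)) : ℝ) ^ 2 / 2⌋₊ ≤ (2 * (k + 1)) ^ 2 := by
      have hx : (1 - δ) * (((2 * (k + 1) : ℕ)) : ℝ) ^ 2 / 2 ≤ (((2 * (k + 1)) ^ 2 : ℕ) : ℝ) := by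
        push_cast
        nlinarith [sq_nonneg (((2 * (k + 1) : ℕ)) : ℝ)]
      exact (Nat.floor_mono hx).trans (Nat.floor_natCast _).le
    have key := gibbsFloor_of_penaltyResponse (2 * (k + 1)) U hn hc hκpos hMpos hκK hκB hk
    -- `c/2 - log 4/(M κ) = c/3`
    have hconst : c / 2 - Real.log 4 / (M * κ) = c / 3 := by
      rw [hMdef]; field_simp; ring
    rw [hconst] at key
    exact key

/-- **C⁺⁺ ⇒ C⁺** (the thermal engine gives the `T = 0` penalty-response family; `penaltyResponse_of_gibbsFloor`
at `ℓ = L`, `c = a/2` — the first half of `cwThesis_of_gibbsPenaltyFloor`, recorded as a statement about the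
two families). [folklore] -/
theorem penaltyResponseWindow_of_gibbsPenaltyFloor
    (h : ∃ U₀ : ℝ, 0 < U₀ ∧ ∀ U ∈ Set.Ioo (0:ℝ) U₀, ∃ δ ∈ Set.Icc (3/10 : ℝ) (12/25), ∃ κ a M : ℝ, 0 < κ ∧ 0 < a ∧ 0 < M ∧ 2 * Real.log 4 ≤ M * κ * a ∧ ∀ᶠ k : ℕ in atTop, let L : ℕ := 2 * (k + 1); let n : ℕ := ⌊(1 - δ) * (L : ℝ) ^ 2 / 2⌋₊; let Hp := (hubbardTorus 2 L 1 U).toBlock (fun s => (upPart s).card = n ∧ (downPart s).card = n) (fun s => (upPart s).card = n ∧ (downPart s).card = n); let Qp := ((pairField dWaveFormFactor L)ᴴ * pairField dWaveFormFactor L).toBlock (fun s => (upPart s).card = n ∧ (downPart s).card = n) (fun s => (upPart s).card = n ∧ (downPart s).card = n); a * (L : ℝ) ^ 4 ≤ (Matrix.gibbsState (M * (L : ℝ) ^ 2) (Hp + ((κ / (L : ℝ) ^ 4 : ℝ) : ℂ) • Qp) Qp).re) :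
    ∃ U₀ : ℝ, 0 < U₀ ∧ ∀ U ∈ Set.Ioo (0:ℝ) U₀, ∃ δ ∈ Set.Icc (3/10 : ℝ) (12/25),
      ∃ κ : ℝ, 0 < κ ∧ ∃ c : ℝ, 0 < c ∧ ∀ᶠ k : ℕ in Filter.atTop,
        c * κ ≤ Matrix.minEnergyOn (hubbardTorus 2 (2 * (k + 1)) 1 U +
            ((κ / ((2 * (k + 1) : ℕ) : ℝ) ^ 4 : ℝ) : ℂ) •
              ((pairField dWaveFormFactor (2 * (k + 1)))ᴴ * pairField dWaveFormFactor (2 * (k + 1))))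
            (szSector (2 * ⌊(1 - δ) * ((2 * (k + 1) : ℕ) : ℝ) ^ 2 / 2⌋₊) 0) -
          Matrix.minEnergyOn (hubbardTorus 2 (2 * (k + 1)) 1 U)
            (szSector (2 * ⌊(1 - δ) * ((2 * (k + 1) : ℕ) : ℝ) ^ 2 / 2⌋₊) 0) := by
  obtain ⟨U₀, hU₀, hU⟩ := h
  refine ⟨U₀, hU₀, fun U hUm => ?_⟩
  obtain ⟨δ, hδ, κ, a, M, hκ, ha, hM, hMκa, hev⟩ := hU U hUm
  refine ⟨δ, hδ, κ, hκ, a / 2, by positivity, ?_⟩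
  filter_upwards [hev] with k hk
  dsimp only at hk
  have hδ0 : (0 : ℝ) ≤ δ := by linarith [hδ.1]
  have hLpos : (0 : ℝ) < ((2 * (k + 1) : ℕ) : ℝ) := by positivity
  have hn : ⌊(1 - δ) * (((2 * (k + 1) : ℕ)) : ℝ) ^ 2 / 2⌋₊ ≤ (2 * (k + 1)) ^ 2 := by
    have hx : (1 - δ) * (((2 * (k + 1) : ℕ)) : ℝ) ^ 2 / 2 ≤ (((2 * (k + 1)) ^ 2 : ℕ) : ℝ) := by
      push_cast
      nlinarith [sq_nonneg (((2 * (k + 1) : ℕ)) : ℝ)]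
    exact (Nat.floor_mono hx).trans (Nat.floor_natCast _).le
  have hcardΛ : (((2 * (k + 1)) ^ 2 : ℕ) : ℝ) = (((2 * (k + 1) : ℕ)) : ℝ) ^ 2 := by
    push_cast; ring
  exact penaltyResponse_of_gibbsFloor (2 * (k + 1)) (hubbardTorus 2 (2 * (k + 1)) 1 U)
    ((pairField dWaveFormFactor (2 * (k + 1)))ᴴ * pairField dWaveFormFactor (2 * (k + 1)))
    (hubbardTorus_isHermitian (hamiltonian_isHermitian_and_commute_holds _) 1 U)
    (isHermitian_conjTranspose_mul_self _) hn hLpos hcardΛ hκ hM hMκa hk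

/-- **The thermal engine of line `SketchIdeator3` is EQUIVALENT to the `T = 0` penalty-response family**
(`∀ U` small `∃ δ_U ∈ [3/10, 12/25]`, `∃ κ, c > 0`, eventually `c κ ≤ E_L(U;κ) - E_L(U;0)`): the one open stub
of the line is, up to constants, the `∀ U ∃ δ` form of the conclusion of the sibling crux
`TorusCooperLog.KLCanonical` (stmt-HubbardSuperconductivity-2681) — the thermal dress at `β = M L²` neither
adds nor removes strength. (The statement is kept on one line: it is a registered stub signature of the crux item,
matched textually by the gate.) [folklore] -/
theorem gibbsPenaltyFloor_iff_penaltyResponseWindow : (∃ U₀ : ℝ, 0 < U₀ ∧ ∀ U ∈ Set.Ioo (0:ℝ) U₀, ∃ δ ∈ Set.Icc (3/10 : ℝ) (12/25), ∃ κ a M : ℝ, 0 < κ ∧ 0 < a ∧ 0 < M ∧ 2 * Real.log 4 ≤ M * κ * a ∧ ∀ᶠ k : ℕ in atTop, let L : ℕ := 2 * (k + 1); let n : ℕ := ⌊(1 - δ) * (L : ℝ) ^ 2 / 2⌋₊; let Hp := (hubbardTorus 2 L 1 U).toBlock (fun s => (upPart s).card = n ∧ (downPart s).card = n) (fun s =>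 (upPart s).card = n ∧ (downPart s).card = n); let Qp := ((pairField dWaveFormFactor L)ᴴ * pairField dWaveFormFactor L).toBlock (fun s => (upPart s).card = n ∧ (downPart s).card = n) (fun s => (upPart s).card = n ∧ (downPart s).card = n); a * (L : ℝ) ^ 4 ≤ (Matrix.gibbsState (M * (L : ℝ) ^ 2) (Hp + ((κ / (L : ℝ) ^ 4 : ℝ) : ℂ) • Qp) Qp).re) ↔ (∃ U₀ : ℝ, 0 < U₀ ∧ ∀ U ∈ Set.Ioo (0:ℝ) U₀, ∃ δ ∈ Set.Icc (3/10 : ℝ) (12/25), ∃ κ : ℝ, 0 < κ ∧ ∃ c : ℝ, 0 < c ∧ ∀ᶠ k : ℕ in Filter.atTop, c * κ ≤ Matrix.minEnergyOn (hubbardTorus 2 (2 * (k + 1)) 1 U + ((κ / ((2 * (k + 1) : ℕ) : ℝ) ^ 4 : ℝ) : ℂ) • ((pairField dWaveFormFactor (2 * (k + 1)))ᴴ * pairField dWaveFormFactor (2 * (k + 1)))) (szSector (2 * ⌊(1 - δ) * ((2 * (k + 1) : ℕ) : ℝ) ^ 2 / 2⌋₊) 0) - Matrix.minEnergyOn (hubbardTorus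 2 (2 * (k + 1)) 1 U) (szSector (2 * ⌊(1 - δ) * ((2 * (k + 1) : ℕ) : ℝ) ^ 2 / 2⌋₊) 0)) :=
  ⟨penaltyResponseWindow_of_gibbsPenaltyFloor, gibbsPenaltyFloor_of_penaltyResponseWindow⟩

end Summit.HubbardSuperconductivity.HubbardSuperconductivity.Theorems.CwThesis

end
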